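import Summits.QuantumFields.YangMills.Theorems.UnitScaleTiltProp7FlatMemberLocalGradient
import Summits.QuantumFields.YangMills.Theorems.UnitScaleTiltProp7ResolventHolderRowMember
import Literature.MathematicalPhysics.QuantumFieldTheory.Balaban1983to89.B5Eq129FreeResolventWeightedAdjointRow
import Literature.MathematicalPhysics.QuantumFieldTheory.Balaban1983to89.B9Eq323KatoDomination
import HarnessLib

/-!
# Route `UnitScaleTilt`, crux K1 «MinimiserStabilityRegPr» (stmt-QuantumFields-19200), EX row (5) `norm_G`, STOREY H, H-road brick H2 — **THE UNWEIGHTED FLAT TWO-POINT HÖLDER LETTER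
# `Hflat⁰` AT THE T³ MEMBER, mass `m = 1`, DISCHARGED**: for `(Δ^η_1 + 1)u = D*_1 f` with `‖f(b)‖ ≤ F`, `‖u(x′) − u(x)‖ ≤ S_H·F·(tdist x x′∕L^(K−n))^{½}` on the window `tdist ≤ L^(K−n)` —
# [Balaban1984PropagatorsI] (1.9) at `A = 0` ∕ [Balaban1984PropagatorsII] (2.43) ∕ [Balaban1985BackgroundPropagators] Thm 3.1 (3.43) flat case — the displayed letter `Hflat` of ✓`Prop7ResolventHolderRowMember` §5 (`a := 0`,
# `m := 1`) from TWO landed inputs: the member's LOCAL flat ½-Hölder estimate ✓`Prop7FlatMemberLocalGradient.exists_localHolder_flat_member` (lit ✓`localHolder_flat_P`, Campanato) and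
# lit's flat VALUE row ✓`B5Eq129FreeResolventWeightedAdjointRow.norm_apply_le_of_resolvent_covDiv_weighted` (GENERIC `P`, here unweighted), glued by the pointwise reading of the equation

Cell `ym3-torus` (HUMAN RULING D-0037; rung R3 = SU(2) YM₃ on T³ — NOT d = 4, NOT infinite volume, NOT a mass gap, NOT Clay).  Width seat `ym3-torus-px19` (gen 15); chair WORD №46 (H2);
19200 evidence `LOCATE-H2-HolderRow-px19g15.md` §1 row `Hflat`.  THEOREMS ONLY (0 `def`, 0 `sorry`, default heartbeats); `--supports stmt-QuantumFields-19200 --as helper`; count-neutral.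

THE MATHEMATICS.  `u = (Δ_1 + 1)⁻¹∂*f` at spacing `η = L^{−(K−n)}`: (i) the pointwise equation `Σ_ν ℓ²((u(y) − u(y−e_ν)) + (u(y) − u(y+e_ν))) + u(y) = ℓ·Σ_ν(f(y−e_ν,ν) − f(y,ν))`,
`ℓ = η⁻¹` (lit ✓`equiv_covLaplaceSiteK_eq_sum`, ✓`equiv_covDivL2K`); (ii) the flat value row, unweighted (`a = 0`): `‖u(y)‖ ≤ S⁰·F`,
`S⁰ = ℓ·Σ_ν 2(1 + 2ℓ∕P_ν)∕√(1 + 4ℓ²)` (`≤ 9` since `ℓ ≤ P_ν∕2`); (iii) the local ½-Hölder estimate on the `4ℓ`-ball with `M_u := S⁰F`, `M_f := F` gives the window row with `S_H := Ch·(S⁰ + 1)`.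
No weight, no gauge field: this is the `R = S = 1` letter print's perturbation argument starts from.

WHAT IS PROVED (ns `Summit.QuantumFields.YangMills.Theorems.Prop7FlatResolventHolderLetterMember`; member `F n K`, weight `c₀ > 0`).
* §1 `inv_eta_ofReal_eq` (`η⁻¹ = L^(K−n)` as a complex scalar; the real form is ✓`Prop7FlatProjectorSeam.inv_eta_eq`), `member_eq_of_flat_eq` (lit flat form at `t = η⁻¹` ⟺ `covLapSite 1 ∕ DstarL2 1` form), `pointwise_of_flat_eq` (the pointwise real equation).
* §2 ★★ `flat_valueRow_member` — `‖u(y)‖ ≤ S⁰·F` (lit's value row at `d = 3`, `a = 0`, `m = 1`, `t = η⁻¹`, `P = periodsT3 F K`; `S⁰` written as lit prints it).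
* §3 ★★★ `Hflat_member_one` — THE LETTER: `∀ u f F, 0 ≤ F → (flat equation, lit form, `t = η⁻¹`, `m = 1`) → (∀ b, ‖f b‖ ≤ F) → ∀ x x′, tdist ≤ L^(K−n) → ‖u x′ − u x‖ ≤ S_H·F·(tdist∕L^(K−n))^{½}`
  with `S_H := Ch·(S⁰ + 1)`, `Ch := exists_localHolder_flat_member.choose` — EXACTLY the `Hflat` binder of ✓`holderRow_resolventDstarL2_unweighted` at `m := 1` (so `exact Hflat_member_one F n K c₀`);
  `S0_nonneg`.
* §4 ★★★ `holderRow_G1_DstarL2_of_gauge_and_grad` — THE DOCKING: the unweighted η-½-Hölder row of `w = (Δ^η_V+1)⁻¹D*_Vf` at the member with `Hflat` DISCHARGED; displayed: gauge rows, `Sad`,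
  `Hgrad⁰`, `hκ` only.
HYP-SAT (★★OWNER RULING №42).  Inputs are the equation (an equality) and a sup bound; the conclusion is an explicit inequality; `Ch` is an anonymous-but-closed constant of the tree (∃-packaged
by ✓p761993, a function of `d = 3` only), `S⁰ ≤ 9` K-free.  Nothing conclusion-shaped is assumed.
HONEST SCOPE.  The flat letter only (`m = 1`, unweighted); the weighted∕general-`m` editions, `Hgrad`, the regular gauge, `ω₁`'s row, `h3`, norm_G, EX, 19200, R3 are NOT proved; the
Yang–Mills mass gap is NOT proved.

References: T. Bałaban, CMP **95** (1984) 17–40 [Balaban1984PropagatorsI] ((1.9) p.19); CMP **96** (1984) 223–250 [Balaban1984PropagatorsII] ((2.43) p.230, Lemma 2.1 (2.61)–(2.63) p.234);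
CMP **99** (1985) 389–434 [Balaban1985BackgroundPropagators] (Thm 3.1 (3.42) p.397, (3.43) p.398, (3.23) p.394).
-/

set_option autoImplicit false

noncomputable section

open scoped InnerProductSpace ComplexConjugate BigOperators Matrix.Norms.L2Operator

namespace Summit.QuantumFields.YangMills.Theorems.Prop7FlatResolventHolderLetterMember

open Literature.MathematicalPhysics.QuantumFieldTheory.Balaban1983to89
open Literature.MathematicalPhysics.QuantumFieldTheory.Balaban1983to89.T3ContinuumYM3Torus
open B4Sect5Torus (TSite tdist tdist_nonneg)
open B4TorusKernel.MultiPeriod (circAbs)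
open B9SectCLatticeCarrier (Bond bpos shift unshift)
open B9Eq311L2Pairing (WL2)
open B11Eq103H1Complex (SiteL2K BondL2K covDivL2K covLaplaceSiteK equiv_covDivL2K greenK)
open B9Eq33CovDerivVector (covDiv_apply)
open B9Eq323KatoDomination (equiv_covLaplaceSiteK_eq_sum)
open B5Eq129FreeResolventWeightedAdjointRow (norm_apply_le_of_resolvent_covDiv_weighted)
open T3SectALandauChart (eta eta_pos)
open Summit.QuantumFields.YangMills.Theorems.Prop7SectET3Transport (periodsT3)
open Summit.QuantumFields.YangMills.Theorems.Prop7SectET3HilbertLetters (W₂ adBg adBgInv DL2 DstarL2 covLapSite)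
open Summit.QuantumFields.YangMills.Theorems.Prop7FlatMemberLocalGradient (inv_eta_cast covLapSite_one_eq DstarL2_one_eq ell_cast exists_localHolder_flat_member)
open Summit.QuantumFields.YangMills.Theorems.Prop7ResolventHolderRowMember (two_le_periodsT3 covLapSite_add_pos holderRow_resolventDstarL2_unweighted)

variable (F : T3Family) (n K : ℕ) (c₀ : ℝ) [Fact (0 < c₀)]

/-! ## §1 Casts and the pointwise reading of the flat equation -/

omit [Fact (0 < c₀)] in
/-- The lit flat scalar at `t = η⁻¹` is the member dictionary's `ℓ`-cast. [cite: Balaban1985BackgroundPropagators, (3.1) p.390] -/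
theorem inv_eta_ofReal_eq : (((eta F n K)⁻¹ : ℝ) : ℂ) = ((((F.L ^ (K - n) : ℕ) : ℝ) : ℝ) : ℂ) := by
  rw [Complex.ofReal_inv, inv_eta_cast]

/-- **lit flat form ⟹ member form**: the flat equation with `t = η⁻¹` written with lit's identity transporters IS `covLapSite 1 u + u = DstarL2 1 f`.
[cite: Balaban1985BackgroundPropagators, (3.23) p.394, (3.8) p.392] -/
theorem member_eq_of_flat_eq {u : SiteL2K ℂ 3 (periodsT3 F K) c₀ W₂} {f : BondL2K ℂ 3 (periodsT3 F K) c₀ W₂}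
    (heq : covLaplaceSiteK (((eta F n K)⁻¹ : ℝ) : ℂ) (fun _ : Bond 3 (periodsT3 F K) => (LinearMap.id : W₂ →ₗ[ℂ] W₂)) (fun _ => LinearMap.id) u + ((1 : ℝ) : ℂ) • u =
      covDivL2K ℂ c₀ (((eta F n K)⁻¹ : ℝ) : ℂ) (fun _ : Bond 3 (periodsT3 F K) => (LinearMap.id : W₂ →ₗ[ℂ] W₂)) f) :
    covLapSite F n K c₀ 1 u + ((1 : ℝ) : ℂ) • u = DstarL2 F n K c₀ 1 f := by
  rw [covLapSite_one_eq, DstarL2_one_eq, ← inv_eta_ofReal_eq]; exact heq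

/-- **THE POINTWISE FLAT EQUATION** (real scalars `ℓ²`, `1`, `ℓ`, `ℓ = η⁻¹`): lit ✓`equiv_covLaplaceSiteK_eq_sum` + ✓`equiv_covDivL2K` at identity transporters.
[cite: Balaban1985BackgroundPropagators, (3.23) p.394, (3.8) p.392] -/
theorem pointwise_of_flat_eq {u : SiteL2K ℂ 3 (periodsT3 F K) c₀ W₂} {f : BondL2K ℂ 3 (periodsT3 F K) c₀ W₂}
    (heq : covLaplaceSiteK (((eta F n K)⁻¹ : ℝ) : ℂ) (fun _ : Bond 3 (periodsT3 F K) => (LinearMap.id : W₂ →ₗ[ℂ] W₂)) (fun _ => LinearMap.id) u + ((1 : ℝ) : ℂ) • u =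
      covDivL2K ℂ c₀ (((eta F n K)⁻¹ : ℝ) : ℂ) (fun _ : Bond 3 (periodsT3 F K) => (LinearMap.id : W₂ →ₗ[ℂ] W₂)) f) :
    ∀ y : TSite 3 (periodsT3 F K), ∑ ν, ((eta F n K)⁻¹ ^ 2) • ((WL2.equiv ℂ (fun _ : TSite 3 (periodsT3 F K) => c₀) W₂ u y - WL2.equiv ℂ (fun _ : TSite 3 (periodsT3 F K) => c₀) W₂ u (unshift ν y)) +
        (WL2.equiv ℂ (fun _ : TSite 3 (periodsT3 F K) => c₀) W₂ u y - WL2.equiv ℂ (fun _ : TSite 3 (periodsT3 F K) => c₀) W₂ u (shift ν y))) +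
        (1 : ℝ) • WL2.equiv ℂ (fun _ : TSite 3 (periodsT3 F K) => c₀) W₂ u y =
      (eta F n K)⁻¹ • ∑ ν, (WL2.equiv ℂ (fun _ : Bond 3 (periodsT3 F K) => c₀) W₂ f (unshift ν y, ν) - WL2.equiv ℂ (fun _ : Bond 3 (periodsT3 F K) => c₀) W₂ f (y, ν)) := by
  intro y
  have e := congr_arg (fun g => WL2.equiv ℂ _ W₂ g y) heq
  simp only [WL2.equiv_add, WL2.equiv_smul, Pi.add_apply, Pi.smul_apply] at e
  have hs := equiv_covLaplaceSiteK_eq_sum (𝕜 := ℂ) (c₀ := c₀) (eta F n K)⁻¹ (fun _ : Bond 3 (periodsT3 F K) => (LinearMap.id : W₂ →ₗ[ℂ] W₂)) (fun _ => LinearMap.id)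
    (fun b w => rfl) u y
  rw [RCLike.ofReal_eq_complex_ofReal] at hs
  rw [hs, equiv_covDivL2K, covDiv_apply] at e
  simp only [LinearMap.id_coe, id_eq, Complex.coe_smul] at e
  exact e

/-! ## §2 The flat VALUE row (unweighted) -/

/-- ★★ **THE FLAT VALUE ROW AT THE MEMBER, UNWEIGHTED**: `(Δ^η_1 + 1)u = D*_1f`, `‖f(b)‖ ≤ F` ⟹ `‖u(y)‖ ≤ S⁰·F`, `S⁰ = ℓ·Σ_ν (1 + e^{−0})(1 + 2ℓ∕(P_ν·√(1 − 0)))∕√((1 − 0)² + 4(1 − 0)ℓ²) + 0`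
as lit prints it at `a = 0` (`d = 3`, `m = 1`, `t = ℓ = η⁻¹`) — ✓`norm_apply_le_of_resolvent_covDiv_weighted`. [cite: Balaban1985BackgroundPropagators, Thm 3.1 (3.42) p.397; Balaban1984PropagatorsII, (2.43) p.230] -/
theorem flat_valueRow_member {u : SiteL2K ℂ 3 (periodsT3 F K) c₀ W₂} {f : BondL2K ℂ 3 (periodsT3 F K) c₀ W₂}
    (heq : covLaplaceSiteK (((eta F n K)⁻¹ : ℝ) : ℂ) (fun _ : Bond 3 (periodsT3 F K) => (LinearMap.id : W₂ →ₗ[ℂ] W₂)) (fun _ => LinearMap.id) u + ((1 : ℝ) : ℂ) • u =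
      covDivL2K ℂ c₀ (((eta F n K)⁻¹ : ℝ) : ℂ) (fun _ : Bond 3 (periodsT3 F K) => (LinearMap.id : W₂ →ₗ[ℂ] W₂)) f)
    {F' : ℝ} (hf : ∀ b : Bond 3 (periodsT3 F K), ‖WL2.equiv ℂ (fun _ : Bond 3 (periodsT3 F K) => c₀) W₂ f b‖ ≤ F') (y : TSite 3 (periodsT3 F K)) :
    ‖WL2.equiv ℂ (fun _ : TSite 3 (periodsT3 F K) => c₀) W₂ u y‖ ≤
      (eta F n K)⁻¹ * (∑ ν : Fin 3, ((1 + Real.exp (-0)) * ((1 + 2 * (eta F n K)⁻¹ / (periodsT3 F K ν * Real.sqrt (1 - 2 * (((3 : ℕ) : ℝ) - 1) * (eta F n K)⁻¹ ^ 2 * (Real.cosh 0 - 1)))) /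
            Real.sqrt ((1 - 2 * (((3 : ℕ) : ℝ) - 1) * (eta F n K)⁻¹ ^ 2 * (Real.cosh 0 - 1)) ^ 2 + 4 * (1 - 2 * (((3 : ℕ) : ℝ) - 1) * (eta F n K)⁻¹ ^ 2 * (Real.cosh 0 - 1)) * (eta F n K)⁻¹ ^ 2)) +
          2 * Real.sinh 0 / (1 - 2 * ((3 : ℕ) : ℝ) * (eta F n K)⁻¹ ^ 2 * (Real.cosh 0 - 1)))) * F' := by
  have hpt := pointwise_of_flat_eq F n K c₀ heq
  have hlam : 2 * ((3 : ℕ) : ℝ) * (eta F n K)⁻¹ ^ 2 * (Real.cosh 0 - 1) < 1 := by rw [Real.cosh_zero, sub_self, mul_zero]; exact one_pos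
  have h := norm_apply_le_of_resolvent_covDiv_weighted (P := periodsT3 F K) (V := W₂) (eta F n K)⁻¹ (inv_pos.2 (eta_pos F n K)) (m := 1) (a := 0) one_pos le_rfl hlam
    (two_le_periodsT3 F K) (u := fun y => WL2.equiv ℂ (fun _ : TSite 3 (periodsT3 F K) => c₀) W₂ u y) (f := fun b => WL2.equiv ℂ (fun _ : Bond 3 (periodsT3 F K) => c₀) W₂ f b)
    (fun x => by simpa only [one_smul] using hpt x) y (F := F')
    (fun b => by rw [zero_mul_prod_cosh]; simpa only [mul_one] using hf b) y
  rw [zero_mul_prod_cosh, mul_one] at h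
  exact h
where
  /-- `∏ cosh(0·…) = 1`. [folklore] -/
  zero_mul_prod_cosh {x₀ x : TSite 3 (periodsT3 F K)} :
      ∏ μ, Real.cosh ((0 : ℝ) * (circAbs (periodsT3 F K μ) ((((x₀ μ : ℕ) : ZMod (periodsT3 F K μ)) - ((x μ : ℕ) : ZMod (periodsT3 F K μ))).val) : ℝ)) = 1 := by
    simp only [zero_mul, Real.cosh_zero, Finset.prod_const_one]

omit [Fact (0 < c₀)] in
/-- `0 ≤ S⁰` (at `a = 0`: `cosh 0 = 1`, `sinh 0 = 0`, every term is a quotient of nonnegative reals). [folklore] -/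
theorem S0_nonneg : 0 ≤ ((eta F n K)⁻¹ * (∑ ν : Fin 3, ((1 + Real.exp (-0)) * ((1 + 2 * (eta F n K)⁻¹ / (periodsT3 F K ν * Real.sqrt (1 - 2 * (((3 : ℕ) : ℝ) - 1) * (eta F n K)⁻¹ ^ 2 * (Real.cosh 0 - 1)))) /
            Real.sqrt ((1 - 2 * (((3 : ℕ) : ℝ) - 1) * (eta F n K)⁻¹ ^ 2 * (Real.cosh 0 - 1)) ^ 2 + 4 * (1 - 2 * (((3 : ℕ) : ℝ) - 1) * (eta F n K)⁻¹ ^ 2 * (Real.cosh 0 - 1)) * (eta F n K)⁻¹ ^ 2)) +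
          2 * Real.sinh 0 / (1 - 2 * ((3 : ℕ) : ℝ) * (eta F n K)⁻¹ ^ 2 * (Real.cosh 0 - 1))))) := by
  rw [Real.cosh_zero, Real.sinh_zero, sub_self]
  simp only [mul_zero, sub_zero, Real.sqrt_one, mul_one, zero_div, add_zero]
  have hη : 0 ≤ (eta F n K)⁻¹ := (inv_pos.2 (eta_pos F n K)).le
  positivity

/-! ## §3 ★★★ The unweighted flat two-point Hölder letter at `m = 1`, discharged -/

/-- ★★★ **`Hflat⁰` AT THE MEMBER, `m = 1`, DISCHARGED**: for every `u f` with `(Δ^η_1 + 1)u = D*_1f` (lit flat form, `t = η⁻¹`) and `‖f(b)‖ ≤ F`, on the window `tdist x x′ ≤ L^(K−n)`: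
`‖u(x′) − u(x)‖ ≤ (Ch·(S⁰ + 1))·F·(tdist x x′∕L^(K−n))^{½}`, `Ch := exists_localHolder_flat_member.choose` (a function of `d = 3` only), `S⁰` the flat value constant of §2 (`≤ 9`) — the
`Hflat` binder of ✓`Prop7ResolventHolderRowMember.holderRow_resolventDstarL2_unweighted` at `m := 1` with `SH := Ch·(S⁰ + 1)`, by `exact`.  Proof: §2 gives the GLOBAL value bound
`M_u := S⁰F`, the data bound is `M_f := F`, and ✓`exists_localHolder_flat_member` (Campanato at the flat member) gives the window row with `Ch·(M_u + M_f)`.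
[cite: Balaban1984PropagatorsI, (1.9) p.19; Balaban1985BackgroundPropagators, Thm 3.1 (3.43) p.398] -/
theorem Hflat_member_one :
    ∀ (u : SiteL2K ℂ 3 (periodsT3 F K) c₀ W₂) (f : BondL2K ℂ 3 (periodsT3 F K) c₀ W₂) (F' : ℝ), 0 ≤ F' →
      covLaplaceSiteK (((eta F n K)⁻¹ : ℝ) : ℂ) (fun _ : Bond 3 (periodsT3 F K) => (LinearMap.id : W₂ →ₗ[ℂ] W₂)) (fun _ => LinearMap.id) u + ((1 : ℝ) : ℂ) • u =
        covDivL2K ℂ c₀ (((eta F n K)⁻¹ : ℝ) : ℂ) (fun _ : Bond 3 (periodsT3 F K) => (LinearMap.id : W₂ →ₗ[ℂ] W₂)) f →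
      (∀ b, ‖WL2.equiv ℂ _ W₂ f b‖ ≤ F') →
      ∀ x x', tdist (periodsT3 F K) x x' ≤ (F.L : ℝ) ^ (K - n) →
        ‖WL2.equiv ℂ _ W₂ u x' - WL2.equiv ℂ _ W₂ u x‖ ≤ (exists_localHolder_flat_member.choose * (((eta F n K)⁻¹ * (∑ ν : Fin 3, ((1 + Real.exp (-0)) * ((1 + 2 * (eta F n K)⁻¹ / (periodsT3 F K ν * Real.sqrt (1 - 2 * (((3 : ℕ) : ℝ) - 1) * (eta F n K)⁻¹ ^ 2 * (Real.cosh 0 - 1)))) /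
            Real.sqrt ((1 - 2 * (((3 : ℕ) : ℝ) - 1) * (eta F n K)⁻¹ ^ 2 * (Real.cosh 0 - 1)) ^ 2 + 4 * (1 - 2 * (((3 : ℕ) : ℝ) - 1) * (eta F n K)⁻¹ ^ 2 * (Real.cosh 0 - 1)) * (eta F n K)⁻¹ ^ 2)) +
          2 * Real.sinh 0 / (1 - 2 * ((3 : ℕ) : ℝ) * (eta F n K)⁻¹ ^ 2 * (Real.cosh 0 - 1))))) + 1)) * F' * (tdist (periodsT3 F K) x x' / (F.L : ℝ) ^ (K - n)) ^ ((1 : ℝ) / 2) := by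
  intro u f F' hF' heq hf x x' hxx'
  have hCh0 := exists_localHolder_flat_member.choose_spec.1
  have hloc := exists_localHolder_flat_member.choose_spec.2
  have hmem := member_eq_of_flat_eq F n K c₀ heq
  have hval : ∀ y : TSite 3 (periodsT3 F K), ‖WL2.equiv ℂ (fun _ : TSite 3 (periodsT3 F K) => c₀) W₂ u y‖ ≤ ((eta F n K)⁻¹ * (∑ ν : Fin 3, ((1 + Real.exp (-0)) * ((1 + 2 * (eta F n K)⁻¹ / (periodsT3 F K ν * Real.sqrt (1 - 2 * (((3 : ℕ) : ℝ) - 1) * (eta F n K)⁻¹ ^ 2 * (Real.cosh 0 - 1)))) /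
            Real.sqrt ((1 - 2 * (((3 : ℕ) : ℝ) - 1) * (eta F n K)⁻¹ ^ 2 * (Real.cosh 0 - 1)) ^ 2 + 4 * (1 - 2 * (((3 : ℕ) : ℝ) - 1) * (eta F n K)⁻¹ ^ 2 * (Real.cosh 0 - 1)) * (eta F n K)⁻¹ ^ 2)) +
          2 * Real.sinh 0 / (1 - 2 * ((3 : ℕ) : ℝ) * (eta F n K)⁻¹ ^ 2 * (Real.cosh 0 - 1))))) * F' :=
    fun y => flat_valueRow_member F n K c₀ heq hf y
  have hMu0 : 0 ≤ ((eta F n K)⁻¹ * (∑ ν : Fin 3, ((1 + Real.exp (-0)) * ((1 + 2 * (eta F n K)⁻¹ / (periodsT3 F K ν * Real.sqrt (1 - 2 * (((3 : ℕ) : ℝ) - 1) * (eta F n K)⁻¹ ^ 2 * (Real.cosh 0 - 1)))) /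
            Real.sqrt ((1 - 2 * (((3 : ℕ) : ℝ) - 1) * (eta F n K)⁻¹ ^ 2 * (Real.cosh 0 - 1)) ^ 2 + 4 * (1 - 2 * (((3 : ℕ) : ℝ) - 1) * (eta F n K)⁻¹ ^ 2 * (Real.cosh 0 - 1)) * (eta F n K)⁻¹ ^ 2)) +
          2 * Real.sinh 0 / (1 - 2 * ((3 : ℕ) : ℝ) * (eta F n K)⁻¹ ^ 2 * (Real.cosh 0 - 1))))) * F' := (norm_nonneg _).trans (hval x)
  have h := hloc F n K c₀ u f x (((eta F n K)⁻¹ * (∑ ν : Fin 3, ((1 + Real.exp (-0)) * ((1 + 2 * (eta F n K)⁻¹ / (periodsT3 F K ν * Real.sqrt (1 - 2 * (((3 : ℕ) : ℝ) - 1) * (eta F n K)⁻¹ ^ 2 * (Real.cosh 0 - 1)))) /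
            Real.sqrt ((1 - 2 * (((3 : ℕ) : ℝ) - 1) * (eta F n K)⁻¹ ^ 2 * (Real.cosh 0 - 1)) ^ 2 + 4 * (1 - 2 * (((3 : ℕ) : ℝ) - 1) * (eta F n K)⁻¹ ^ 2 * (Real.cosh 0 - 1)) * (eta F n K)⁻¹ ^ 2)) +
          2 * Real.sinh 0 / (1 - 2 * ((3 : ℕ) : ℝ) * (eta F n K)⁻¹ ^ 2 * (Real.cosh 0 - 1))))) * F') F' hMu0 hF' hmem (fun y _ => hval y) (fun b _ => hf b) x' hxx'
  have e : exists_localHolder_flat_member.choose * (((eta F n K)⁻¹ * (∑ ν : Fin 3, ((1 + Real.exp (-0)) * ((1 + 2 * (eta F n K)⁻¹ / (periodsT3 F K ν * Real.sqrt (1 - 2 * (((3 : ℕ) : ℝ) - 1) * (eta F n K)⁻¹ ^ 2 * (Real.cosh 0 - 1)))) /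
            Real.sqrt ((1 - 2 * (((3 : ℕ) : ℝ) - 1) * (eta F n K)⁻¹ ^ 2 * (Real.cosh 0 - 1)) ^ 2 + 4 * (1 - 2 * (((3 : ℕ) : ℝ) - 1) * (eta F n K)⁻¹ ^ 2 * (Real.cosh 0 - 1)) * (eta F n K)⁻¹ ^ 2)) +
          2 * Real.sinh 0 / (1 - 2 * ((3 : ℕ) : ℝ) * (eta F n K)⁻¹ ^ 2 * (Real.cosh 0 - 1))))) * F' + F') = exists_localHolder_flat_member.choose * (((eta F n K)⁻¹ * (∑ ν : Fin 3, ((1 + Real.exp (-0)) * ((1 + 2 * (eta F n K)⁻¹ / (periodsT3 F K ν * Real.sqrt (1 - 2 * (((3 : ℕ) : ℝ) - 1) * (eta F n K)⁻¹ ^ 2 * (Real.cosh 0 - 1)))) /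
            Real.sqrt ((1 - 2 * (((3 : ℕ) : ℝ) - 1) * (eta F n K)⁻¹ ^ 2 * (Real.cosh 0 - 1)) ^ 2 + 4 * (1 - 2 * (((3 : ℕ) : ℝ) - 1) * (eta F n K)⁻¹ ^ 2 * (Real.cosh 0 - 1)) * (eta F n K)⁻¹ ^ 2)) +
          2 * Real.sinh 0 / (1 - 2 * ((3 : ℕ) : ℝ) * (eta F n K)⁻¹ ^ 2 * (Real.cosh 0 - 1))))) + 1) * F' := by ring
  rw [e] at h
  exact h

/-! ## §4 ★★★ Docking: the unweighted Hölder row of `w = (Δ^η_V + 1)⁻¹D*_Vf` with the flat letter DISCHARGED -/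

/-- ★★★ **THE η-½-HÖLDER ROW OF `w = G_1 D*_V f` (`G_1 = (Δ^η_V + 1)⁻¹`) AT THE MEMBER, REGULAR GAUGE, FLAT LETTER DISCHARGED**: ✓`holderRow_resolventDstarL2_unweighted` at `m := 1` with
`Hflat := Hflat_member_one` (§3).  Displayed now: ONLY the regular-gauge rows `hRε hSε hSε'` (✓`Prop7TransporterRowsOfSmallField` reads them off `‖V_b − 1‖`, `‖V(x,μ) − V(x−e_μ,μ)‖`),
`Sad` (pinned), the gradient letter `Hgrad⁰` of `G_1` on sup data, and the window `hκ`.  [cite: Balaban1985BackgroundPropagators, Thm 3.1 (3.43) p.398, (3.35) p.396; Balaban1984PropagatorsI, (1.9) p.19] -/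
theorem holderRow_G1_DstarL2_of_gauge_and_grad (V : GaugeField (F.P K) 0 (Matrix.specialUnitaryGroup (Fin 2) ℂ))
    {ε ε' : ℝ} (hε : 0 ≤ ε) (hε' : 0 ≤ ε')
    (hRε : ∀ (b : Bond 3 (periodsT3 F K)) (w : W₂), ‖adBg F K V b w - w‖ ≤ ε * ‖w‖)
    (hSε : ∀ (b : Bond 3 (periodsT3 F K)) (w : W₂), ‖adBgInv F K V b w - w‖ ≤ ε * ‖w‖)
    (hSε' : ∀ (x : TSite 3 (periodsT3 F K)) (μ : Fin 3) (w : W₂), ‖adBgInv F K V (x, μ) w - adBgInv F K V (unshift μ x, μ) w‖ ≤ ε' * ‖w‖)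
    (Sad : ℝ)
    (hSad : Sad = (eta F n K)⁻¹ * ∑ ν : Fin 3, ((1 + Real.exp (-0)) * ((1 + 2 * (eta F n K)⁻¹ / (periodsT3 F K ν * Real.sqrt (1 - 2 * (((3 : ℕ) : ℝ) - 1) * (eta F n K)⁻¹ ^ 2 * (Real.cosh 0 - 1)))) /
            Real.sqrt ((1 - 2 * (((3 : ℕ) : ℝ) - 1) * (eta F n K)⁻¹ ^ 2 * (Real.cosh 0 - 1)) ^ 2 + 4 * (1 - 2 * (((3 : ℕ) : ℝ) - 1) * (eta F n K)⁻¹ ^ 2 * (Real.cosh 0 - 1)) * (eta F n K)⁻¹ ^ 2)) +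
          2 * Real.sinh 0 / (1 - 2 * ((3 : ℕ) : ℝ) * (eta F n K)⁻¹ ^ 2 * (Real.cosh 0 - 1))))
    (Θg : ℝ) (hΘg : 0 ≤ Θg)
    (Hgrad : ∀ (g : SiteL2K ℂ 3 (periodsT3 F K) c₀ W₂) (Gs : ℝ), 0 ≤ Gs → (∀ y, ‖WL2.equiv ℂ _ W₂ g y‖ ≤ Gs) →
      ∀ b, ‖WL2.equiv ℂ _ W₂ (DL2 F n K c₀ V (greenK (covLapSite F n K c₀ V + ((1 : ℝ) : ℂ) • LinearMap.id) (covLapSite_add_pos F n K c₀ V one_pos) g)) b‖ ≤ Θg * Gs)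
    (hκ : (eta F n K)⁻¹ * ε * Sad * (Real.exp 0 + 1) ≤ 1 / 2)
    (f : BondL2K ℂ 3 (periodsT3 F K) c₀ W₂) (F' : ℝ) (hF : 0 ≤ F') (hf : ∀ b, ‖WL2.equiv ℂ _ W₂ f b‖ ≤ F')
    (y y' : TSite 3 (periodsT3 F K)) (hyy : tdist (periodsT3 F K) y y' ≤ (F.L : ℝ) ^ (K - n)) :
    ‖WL2.equiv ℂ _ W₂ (greenK (covLapSite F n K c₀ V + ((1 : ℝ) : ℂ) • LinearMap.id) (covLapSite_add_pos F n K c₀ V one_pos) (DstarL2 F n K c₀ V f)) y'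
        - WL2.equiv ℂ _ W₂ (greenK (covLapSite F n K c₀ V + ((1 : ℝ) : ℂ) • LinearMap.id) (covLapSite_add_pos F n K c₀ V one_pos) (DstarL2 F n K c₀ V f)) y‖ ≤
      (2 * ((exists_localHolder_flat_member.choose * (((eta F n K)⁻¹ * (∑ ν : Fin 3, ((1 + Real.exp (-0)) * ((1 + 2 * (eta F n K)⁻¹ / (periodsT3 F K ν * Real.sqrt (1 - 2 * (((3 : ℕ) : ℝ) - 1) * (eta F n K)⁻¹ ^ 2 * (Real.cosh 0 - 1)))) /
            Real.sqrt ((1 - 2 * (((3 : ℕ) : ℝ) - 1) * (eta F n K)⁻¹ ^ 2 * (Real.cosh 0 - 1)) ^ 2 + 4 * (1 - 2 * (((3 : ℕ) : ℝ) - 1) * (eta F n K)⁻¹ ^ 2 * (Real.cosh 0 - 1)) * (eta F n K)⁻¹ ^ 2)) +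
          2 * Real.sinh 0 / (1 - 2 * ((3 : ℕ) : ℝ) * (eta F n K)⁻¹ ^ 2 * (Real.cosh 0 - 1))))) + 1)) + ((3 : ℕ) : ℝ) * (F.L : ℝ) ^ (K - n) * ((((eta F n K)⁻¹)⁻¹ * Θg + ε * (1 - 2 * ((3 : ℕ) : ℝ) * (eta F n K)⁻¹ ^ 2 * (Real.cosh 0 - 1))⁻¹) * Real.exp (0 * ((3 : ℕ) : ℝ) * ((F.L : ℝ) ^ (K - n) + 1))) * ((eta F n K)⁻¹ ^ 2 * ((3 : ℕ) : ℝ) * (ε ^ 2 * Real.exp 0 + ε') * Sad + (eta F n K)⁻¹ * ε * ((3 : ℕ) : ℝ) * Real.exp 0))) * F' * (tdist (periodsT3 F K) y y' / (F.L : ℝ) ^ (K - n)) ^ ((1 : ℝ) / 2) * (1 : ℝ) :=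
  holderRow_resolventDstarL2_unweighted F n K c₀ V one_pos hε hε' hRε hSε hSε' Sad hSad _
    (mul_nonneg exists_localHolder_flat_member.choose_spec.1 (by linarith [S0_nonneg F n K]))
    (Hflat_member_one F n K c₀) Θg hΘg Hgrad hκ f F' hF hf y y' hyy

end Summit.QuantumFields.YangMills.Theorems.Prop7FlatResolventHolderLetterMember

end
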